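import Literature.Analysis.SegalBargmann.HermiteExpansionSchwartz
import HarnessLib

/-!
# Hermite multiplier operators on `𝒮(ℝⁿ)` (Reed–Simon I, Thm V.13; Folland 1989, §1.7)

Topic `Analysis/SegalBargmann`; namespace `Literature.Analysis.SegalBargmann`.  Continuation of
`Literature.Analysis.SegalBargmann.HermiteExpansionSchwartz` (the `N`-representation theorem: `f = Σ_β c_β(f) h_β` in
`𝒮(ℝ^σ)`, coefficients rapidly decreasing).  A multiplier `m : ℕ^σ → ℂ` of POLYNOMIAL GROWTH, `‖m_β‖ ≤ M (|β|+1)^a`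
(`IsPolyBounded m a M`), acts on `𝒮(ℝ^σ)` by

  `T_m f = Σ_β m_β c_β(f) h_β`,

a Schwartz-convergent series; this file proves that `T_m` is a CONTINUOUS linear operator on `𝒮(ℝ^σ, ℂ)`
(`hermiteMultiplierCLM`), with `c_α(T_m f) = m_α c_α(f)`, `T_m h_α = m_α h_α`, `T_{m m'} = T_m T_{m'}`, `T_m T_{m'} = T_{m'} T_m`,
`T_1 = 1`.  (The sequel `HermiteOscillatorTorus` specialises to the Fourier multiplier `(−i)^{|β|}` and to the unimodular
multipliers `e^{iθ·β}` — the oscillator torus acting on `𝒮(ℝ^σ)`.)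

Continuity (§1–§2): `p_{k,l}(T_m f) ≤ C Σ_β (|β|+1)^{k+l+n+1} ‖m_β c_β(f)‖ ≤ C M 2^j (‖f‖_{L²} + ‖N^j f‖_{L²}) Σ_β(|β|+1)^{−(n+2)}`
(`HermiteExpansionSchwartz`, `HermiteCoefficientDecay`) and `‖g‖_{L²} ≤ K_σ (p_{0,0}(g) + p_{n+1,0}(g))`, so `T_m` is bounded
seminorm-by-seminorm (Mathlib `WithSeminorms.continuous_of_isBounded`).  Everything is proved from Mathlib and the
imported tree files; no cited fact is used as a hypothesis.

## References

* M. Reed, B. Simon, *Methods of Modern Mathematical Physics I*, Theorem V.13 and the Appendix to §V.3.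
* G. B. Folland, *Harmonic Analysis in Phase Space*, Annals of Mathematics Studies 122, Princeton UP (1989), §1.7 and
  Ch. 4 §4 (the metaplectic representation on the compact torus).  [cite: Folland1989, §1.7]

## Provenance

Written for the tree under the LEAN-IN-TREE rule (2026-08-18) by the pub-hodgecm formalisation cell (model-construction
sub-cell, seat mc-binder-2).
-/

set_option autoImplicit false

noncomputable section

open MvPolynomial Complex SchwartzMap MeasureTheory Filter Topology Module
open scoped BigOperators Real NNReal

namespace Literature.Analysis.SegalBargmann

variable {σ : Type*} [Fintype σ] [DecidableEq σ]

/-! ## §1  The `L²` norm is controlled by Schwartz seminorms -/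

section L2Control

omit [DecidableEq σ] in
/-- **`‖g‖_{L²} ≤ K_σ (p_{0,0}(g) + p_{n+1,0}(g))`** with `K_σ = √(2^{n+1} ∫ (1+‖x‖)^{−(n+1)})` (`n = |σ|`). [folklore] -/
theorem sqrt_integral_norm_sq_le_seminorm (g : 𝓢(EuclideanSpace ℝ σ, ℂ)) :
    Real.sqrt (∫ x : EuclideanSpace ℝ σ, ‖g x‖ ^ 2) ≤
      Real.sqrt (2 ^ (Fintype.card σ + 1) *
          ∫ x : EuclideanSpace ℝ σ, (1 + ‖x‖) ^ (-((Fintype.card σ + 1 : ℕ) : ℝ))) *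
        (SchwartzMap.seminorm ℂ 0 0 g + SchwartzMap.seminorm ℂ (Fintype.card σ + 1) 0 g) := by
  set r : ℕ := Fintype.card σ + 1 with hr
  set a : ℝ := SchwartzMap.seminorm ℂ 0 0 g with ha
  set b : ℝ := SchwartzMap.seminorm ℂ r 0 g with hb
  have ha0 : 0 ≤ a := apply_nonneg _ _
  have hb0 : 0 ≤ b := apply_nonneg _ _
  set w : EuclideanSpace ℝ σ → ℝ := fun x => (1 + ‖x‖) ^ (-(r : ℝ)) with hw
  have hw0 : ∀ x : EuclideanSpace ℝ σ, 0 ≤ w x := fun x => Real.rpow_nonneg (by positivity) _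
  have hwint : Integrable w := by
    refine integrable_one_add_norm ?_
    rw [finrank_euclideanSpace, hr]
    push_cast
    linarith
  -- pointwise: `‖g x‖² ≤ 2^r (a+b)² w x`
  have hpt : ∀ x : EuclideanSpace ℝ σ, ‖g x‖ ^ 2 ≤ 2 ^ r * (a + b) ^ 2 * w x := by
    intro x
    have hx1 : 0 < 1 + ‖x‖ := by positivity
    have h1 : ‖g x‖ ≤ a := SchwartzMap.norm_le_seminorm ℂ g x
    have h2 : ‖x‖ ^ r * ‖g x‖ ≤ b := by
      have := SchwartzMap.le_seminorm ℂ r 0 g x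
      rwa [norm_iteratedFDeriv_zero] at this
    have h3 : (1 + ‖x‖) ^ r * ‖g x‖ ≤ 2 ^ r * (a + b) := by
      have h4 := add_one_pow_le_two_pow_mul (norm_nonneg x) r
      calc (1 + ‖x‖) ^ r * ‖g x‖ = (‖x‖ + 1) ^ r * ‖g x‖ := by rw [add_comm]
        _ ≤ 2 ^ r * (‖x‖ ^ r + 1) * ‖g x‖ := mul_le_mul_of_nonneg_right h4 (norm_nonneg _)
        _ = 2 ^ r * (‖x‖ ^ r * ‖g x‖ + ‖g x‖) := by ring
        _ ≤ 2 ^ r * (b + a) := by gcongr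
        _ = 2 ^ r * (a + b) := by ring
    have h5 : ‖g x‖ ≤ 2 ^ r * (a + b) * w x := by
      have hwx : w x = ((1 + ‖x‖) ^ r)⁻¹ := by
        rw [hw]
        exact (Real.rpow_neg hx1.le _).trans (by rw [Real.rpow_natCast])
      rw [hwx, ← div_eq_mul_inv, le_div_iff₀ (pow_pos hx1 r)]
      calc ‖g x‖ * (1 + ‖x‖) ^ r = (1 + ‖x‖) ^ r * ‖g x‖ := mul_comm _ _
        _ ≤ 2 ^ r * (a + b) := h3
    have h6 : ‖g x‖ ≤ a + b := h1.trans (le_add_of_nonneg_right hb0)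
    calc ‖g x‖ ^ 2 = ‖g x‖ * ‖g x‖ := sq _
      _ ≤ (2 ^ r * (a + b) * w x) * (a + b) := mul_le_mul h5 h6 (norm_nonneg _) (by positivity)
      _ = 2 ^ r * (a + b) ^ 2 * w x := by ring
  have hint : ∫ x : EuclideanSpace ℝ σ, ‖g x‖ ^ 2 ≤ 2 ^ r * (a + b) ^ 2 * ∫ x : EuclideanSpace ℝ σ, w x := by
    rw [← integral_const_mul]
    exact integral_mono (integrable_norm_sq g) (hwint.const_mul _) hpt
  calc Real.sqrt (∫ x : EuclideanSpace ℝ σ, ‖g x‖ ^ 2)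
      ≤ Real.sqrt (2 ^ r * (a + b) ^ 2 * ∫ x : EuclideanSpace ℝ σ, w x) := Real.sqrt_le_sqrt hint
    _ = Real.sqrt (2 ^ r * ∫ x : EuclideanSpace ℝ σ, w x) * (a + b) := by
        rw [show 2 ^ r * (a + b) ^ 2 * ∫ x : EuclideanSpace ℝ σ, w x =
            (2 ^ r * ∫ x : EuclideanSpace ℝ σ, w x) * (a + b) ^ 2 by ring,
          Real.sqrt_mul' _ (sq_nonneg _), Real.sqrt_sq (by positivity)]

omit [DecidableEq σ] in
/-- **`‖T f‖_{L²} ≤ C · (s.sup p)(f)`** for every continuous linear operator `T` on `𝒮(ℝ^σ, ℂ)`: the `L²` norm after `T`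
is controlled by finitely many Schwartz seminorms (Mathlib `Seminorm.bound_of_continuous`). [folklore] -/
theorem exists_sqrt_integral_norm_sq_le_sup_seminorm
    (T : 𝓢(EuclideanSpace ℝ σ, ℂ) →L[ℂ] 𝓢(EuclideanSpace ℝ σ, ℂ)) :
    ∃ (s : Finset (ℕ × ℕ)) (C : ℝ), 0 ≤ C ∧ ∀ f : 𝓢(EuclideanSpace ℝ σ, ℂ),
      Real.sqrt (∫ x : EuclideanSpace ℝ σ, ‖T f x‖ ^ 2) ≤
        C * (s.sup (schwartzSeminormFamily ℂ (EuclideanSpace ℝ σ) ℂ)) f := by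
  set n : ℕ := Fintype.card σ with hn
  have hW := schwartz_withSeminorms ℂ (EuclideanSpace ℝ σ) ℂ
  set q₁ : Seminorm ℂ 𝓢(EuclideanSpace ℝ σ, ℂ) := SchwartzMap.seminorm ℂ 0 0 with hq₁
  set q₂ : Seminorm ℂ 𝓢(EuclideanSpace ℝ σ, ℂ) := SchwartzMap.seminorm ℂ (n + 1) 0 with hq₂
  have hc₁ : Continuous ⇑(q₁.comp T.toLinearMap) := by
    change Continuous fun f => q₁ (T f)
    exact (hW.continuous_seminorm (0, 0)).comp T.continuous
  have hc₂ : Continuous ⇑(q₂.comp T.toLinearMap) := by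
    change Continuous fun f => q₂ (T f)
    exact (hW.continuous_seminorm (n + 1, 0)).comp T.continuous
  obtain ⟨s₁, C₁, -, h₁⟩ := Seminorm.bound_of_continuous hW _ hc₁
  obtain ⟨s₂, C₂, -, h₂⟩ := Seminorm.bound_of_continuous hW _ hc₂
  set K : ℝ := Real.sqrt (2 ^ (n + 1) *
    ∫ x : EuclideanSpace ℝ σ, (1 + ‖x‖) ^ (-((n + 1 : ℕ) : ℝ))) with hK
  set S := (s₁ ∪ s₂).sup (schwartzSeminormFamily ℂ (EuclideanSpace ℝ σ) ℂ) with hS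
  have hS₁ : ∀ f, (s₁.sup (schwartzSeminormFamily ℂ (EuclideanSpace ℝ σ) ℂ)) f ≤ S f := fun f =>
    Seminorm.le_def.mp (Finset.sup_mono Finset.subset_union_left) f
  have hS₂ : ∀ f, (s₂.sup (schwartzSeminormFamily ℂ (EuclideanSpace ℝ σ) ℂ)) f ≤ S f := fun f =>
    Seminorm.le_def.mp (Finset.sup_mono Finset.subset_union_right) f
  refine ⟨s₁ ∪ s₂, K * (C₁ + C₂), by positivity, fun f => ?_⟩
  have e1 : q₁ (T f) ≤ C₁ * S f := by
    have h := Seminorm.le_def.mp h₁ f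
    rw [Seminorm.comp_apply, smul_apply, NNReal.smul_def, smul_eq_mul] at h
    exact h.trans (mul_le_mul_of_nonneg_left (hS₁ f) C₁.coe_nonneg)
  have e2 : q₂ (T f) ≤ C₂ * S f := by
    have h := Seminorm.le_def.mp h₂ f
    rw [Seminorm.comp_apply, smul_apply, NNReal.smul_def, smul_eq_mul] at h
    exact h.trans (mul_le_mul_of_nonneg_left (hS₂ f) C₂.coe_nonneg)
  have hA := sqrt_integral_norm_sq_le_seminorm (T f)
  rw [← hn, ← hK, ← hq₁, ← hq₂] at hA
  calc Real.sqrt (∫ x : EuclideanSpace ℝ σ, ‖T f x‖ ^ 2)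
      ≤ K * (q₁ (T f) + q₂ (T f)) := hA
    _ ≤ K * (C₁ * S f + C₂ * S f) := by gcongr
    _ = K * (C₁ + C₂) * S f := by ring

end L2Control

/-! ## §2  Hermite multiplier operators -/

section Multiplier

/-- **A multiplier of polynomial growth** on the lattice `ℕ^σ`: `‖m_β‖ ≤ M (|β|+1)^a`. [folklore] -/
def IsPolyBounded (m : (σ →₀ ℕ) → ℂ) (a : ℕ) (M : ℝ) : Prop :=
  ∀ β : σ →₀ ℕ, ‖m β‖ ≤ M * ((β.degree : ℝ) + 1) ^ a

variable {m m' : (σ →₀ ℕ) → ℂ} {a a' : ℕ} {M M' : ℝ}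

omit [Fintype σ] [DecidableEq σ] in
/-- The constant of a polynomial bound is `≥ 0`. [folklore] -/
theorem IsPolyBounded.nonneg (hm : IsPolyBounded m a M) : 0 ≤ M := by
  have h := hm 0
  rw [map_zero, Nat.cast_zero, zero_add, one_pow, mul_one] at h
  exact (norm_nonneg _).trans h

omit [Fintype σ] [DecidableEq σ] in
/-- Products of polynomially bounded multipliers are polynomially bounded. [folklore] -/
theorem IsPolyBounded.mul (hm : IsPolyBounded m a M) (hm' : IsPolyBounded m' a' M') :
    IsPolyBounded (m * m') (a + a') (M * M') := fun β => by
  rw [Pi.mul_apply, norm_mul, pow_add]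
  calc ‖m β‖ * ‖m' β‖ ≤ (M * ((β.degree : ℝ) + 1) ^ a) * (M' * ((β.degree : ℝ) + 1) ^ a') :=
        mul_le_mul (hm β) (hm' β) (norm_nonneg _) (mul_nonneg hm.nonneg (by positivity))
    _ = M * M' * (((β.degree : ℝ) + 1) ^ a * ((β.degree : ℝ) + 1) ^ a') := by ring

omit [Fintype σ] [DecidableEq σ] in
/-- Unimodular (more generally bounded) multipliers are polynomially bounded of degree `0`. [folklore] -/
theorem isPolyBounded_of_norm_le {m : (σ →₀ ℕ) → ℂ} {M : ℝ} (h : ∀ β, ‖m β‖ ≤ M) : IsPolyBounded m 0 M :=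
  fun β => by rw [pow_zero, mul_one]; exact h β

/-- The twisted coefficient family `m_β c_β(f)` of a Schwartz function is rapidly decreasing. [cite: Folland1989, §1.7] -/
theorem IsPolyBounded.summable (hm : IsPolyBounded m a M) (f : 𝓢(EuclideanSpace ℝ σ, ℂ)) (μ : ℕ) :
    Summable fun β : σ →₀ ℕ => ((β.degree : ℝ) + 1) ^ μ * ‖m β * hermiteCoeff β f‖ := by
  refine ((summable_degree_pow_mul_norm_hermiteCoeff (μ + a) f).mul_left M).of_nonneg_of_le
    (fun β => by positivity) fun β => ?_
  rw [norm_mul, pow_add]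
  calc ((β.degree : ℝ) + 1) ^ μ * (‖m β‖ * ‖hermiteCoeff β f‖)
      ≤ ((β.degree : ℝ) + 1) ^ μ * ((M * ((β.degree : ℝ) + 1) ^ a) * ‖hermiteCoeff β f‖) := by
        gcongr
        exact hm β
    _ = M * (((β.degree : ℝ) + 1) ^ μ * ((β.degree : ℝ) + 1) ^ a * ‖hermiteCoeff β f‖) := by ring

/-- `Σ_β (|β|+1)^μ ‖m_β c_β(f)‖ ≤ M Σ_β (|β|+1)^{μ+a} ‖c_β(f)‖`. [folklore] -/
theorem IsPolyBounded.tsum_le (hm : IsPolyBounded m a M) (f : 𝓢(EuclideanSpace ℝ σ, ℂ)) (μ : ℕ) :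
    ∑' β : σ →₀ ℕ, ((β.degree : ℝ) + 1) ^ μ * ‖m β * hermiteCoeff β f‖ ≤
      M * ∑' β : σ →₀ ℕ, ((β.degree : ℝ) + 1) ^ (μ + a) * ‖hermiteCoeff β f‖ := by
  rw [← tsum_mul_left]
  refine (hm.summable f μ).tsum_le_tsum (fun β => ?_)
    ((summable_degree_pow_mul_norm_hermiteCoeff (μ + a) f).mul_left M)
  rw [norm_mul, pow_add]
  calc ((β.degree : ℝ) + 1) ^ μ * (‖m β‖ * ‖hermiteCoeff β f‖)
      ≤ ((β.degree : ℝ) + 1) ^ μ * ((M * ((β.degree : ℝ) + 1) ^ a) * ‖hermiteCoeff β f‖) := by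
        gcongr
        exact hm β
    _ = M * (((β.degree : ℝ) + 1) ^ μ * ((β.degree : ℝ) + 1) ^ a * ‖hermiteCoeff β f‖) := by ring

variable (m)

/-- **The Hermite multiplier `T_m f = Σ_β m_β c_β(f) h_β`** as a linear map on `𝒮(ℝ^σ, ℂ)` (the series converges in
`𝒮`, `HermiteExpansionSchwartz.summable_smul_hermiteSchwartz_herm`). [folklore] -/
def hermiteMultiplierₗ (hm : IsPolyBounded m a M) : 𝓢(EuclideanSpace ℝ σ, ℂ) →ₗ[ℂ] 𝓢(EuclideanSpace ℝ σ, ℂ) where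
  toFun f := ∑' β : σ →₀ ℕ, (m β * hermiteCoeff β f) • hermiteSchwartz (herm β)
  map_add' f g := by
    have hf := summable_smul_hermiteSchwartz_herm (hm.summable f)
    have hg := summable_smul_hermiteSchwartz_herm (hm.summable g)
    rw [← hf.tsum_add hg]
    congr 1
    funext β
    rw [hermiteCoeff_add, mul_add, add_smul]
  map_smul' c f := by
    have hf := summable_smul_hermiteSchwartz_herm (hm.summable f)
    rw [RingHom.id_apply, ← hf.tsum_const_smul c]
    congr 1
    funext β
    rw [hermiteCoeff_smul, smul_smul, show m β * (c * hermiteCoeff β f) = c * (m β * hermiteCoeff β f) by ring]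

/-- The defining series: `Σ_β m_β c_β(f) h_β = T_m f` in `𝒮(ℝ^σ)`. [folklore] -/
theorem hasSum_hermiteMultiplierₗ (hm : IsPolyBounded m a M) (f : 𝓢(EuclideanSpace ℝ σ, ℂ)) :
    HasSum (fun β : σ →₀ ℕ => (m β * hermiteCoeff β f) • hermiteSchwartz (herm β)) (hermiteMultiplierₗ m hm f) :=
  (summable_smul_hermiteSchwartz_herm (hm.summable f)).hasSum

/-- **`c_α(T_m f) = m_α c_α(f)`.** [folklore] -/
theorem hermiteCoeff_hermiteMultiplierₗ (hm : IsPolyBounded m a M) (f : 𝓢(EuclideanSpace ℝ σ, ℂ)) (α : σ →₀ ℕ) :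
    hermiteCoeff α (hermiteMultiplierₗ m hm f) = m α * hermiteCoeff α f :=
  hermiteCoeff_of_hasSum (hasSum_hermiteMultiplierₗ m hm f) α

/-- **`T_m` is continuous on `𝒮(ℝ^σ, ℂ)`**: seminorm by seminorm,
`p_{k,l}(T_m f) ≤ C_{k,l} M 2^j Σ_β(|β|+1)^{−(n+2)} · (‖f‖_{L²} + ‖N^j f‖_{L²})`, `j = k+l+n+1+a+(n+2)`, and the two `L²`
norms are controlled by finitely many Schwartz seminorms. [cite: Folland1989, §1.7] -/
theorem continuous_hermiteMultiplierₗ (hm : IsPolyBounded m a M) : Continuous (hermiteMultiplierₗ m hm) := by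
  set n : ℕ := Fintype.card σ with hn
  have hW := schwartz_withSeminorms ℂ (EuclideanSpace ℝ σ) ℂ
  refine WithSeminorms.continuous_of_isBounded hW hW (hermiteMultiplierₗ m hm)
    (Seminorm.IsBounded.of_real fun i => ?_)
  obtain ⟨k, l⟩ := i
  obtain ⟨C, hC0, hC⟩ := exists_seminorm_hermiteSchwartz_herm_le (σ := σ) k l
  set j : ℕ := (k + l + n + 1 + a) + (n + 2) with hj
  obtain ⟨s₁, C₁, hC₁0, h₁⟩ :=
    exists_sqrt_integral_norm_sq_le_sup_seminorm (ContinuousLinearMap.id ℂ (𝓢(EuclideanSpace ℝ σ, ℂ)))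
  obtain ⟨s₂, C₂, hC₂0, h₂⟩ :=
    exists_sqrt_integral_norm_sq_le_sup_seminorm ((numberOpCLM : 𝓢(EuclideanSpace ℝ σ, ℂ) →L[ℂ] _) ^ j)
  set W : ℝ := ∑' β : σ →₀ ℕ, (((β.degree : ℝ) + 1) ^ (n + 2))⁻¹ with hWdef
  have hW0 : 0 ≤ W := tsum_nonneg fun β => by positivity
  set S := (s₁ ∪ s₂).sup (schwartzSeminormFamily ℂ (EuclideanSpace ℝ σ) ℂ) with hS
  have hS₁ : ∀ f, (s₁.sup (schwartzSeminormFamily ℂ (EuclideanSpace ℝ σ) ℂ)) f ≤ S f := fun f =>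
    Seminorm.le_def.mp (Finset.sup_mono Finset.subset_union_left) f
  have hS₂ : ∀ f, (s₂.sup (schwartzSeminormFamily ℂ (EuclideanSpace ℝ σ) ℂ)) f ≤ S f := fun f =>
    Seminorm.le_def.mp (Finset.sup_mono Finset.subset_union_right) f
  refine ⟨s₁ ∪ s₂, C * (M * (2 ^ j * (C₁ + C₂) * W)), fun f => ?_⟩
  show SchwartzMap.seminorm ℂ k l (hermiteMultiplierₗ m hm f) ≤ C * (M * (2 ^ j * (C₁ + C₂) * W)) * S f
  have e1 := seminorm_le_of_hasSum hC0 hC (hasSum_hermiteMultiplierₗ m hm f) (hm.summable f _)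
  have e2 := hm.tsum_le f (k + l + Fintype.card σ + 1)
  have e3 := tsum_degree_pow_mul_norm_hermiteCoeff_le (k + l + Fintype.card σ + 1 + a) f
  rw [← hn] at e2 e3
  rw [← hj, ← hWdef] at e3
  have e4 : Real.sqrt (∫ x : EuclideanSpace ℝ σ, ‖f x‖ ^ 2) ≤ C₁ * S f := by
    have h := h₁ f
    simp only [ContinuousLinearMap.coe_id', id_eq] at h
    exact h.trans (mul_le_mul_of_nonneg_left (hS₁ f) hC₁0)
  have e5 : Real.sqrt (∫ x : EuclideanSpace ℝ σ, ‖(numberOpCLM ^ j) f x‖ ^ 2) ≤ C₂ * S f :=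
    (h₂ f).trans (mul_le_mul_of_nonneg_left (hS₂ f) hC₂0)
  have hM := hm.nonneg
  calc SchwartzMap.seminorm ℂ k l (hermiteMultiplierₗ m hm f)
      ≤ C * ∑' β : σ →₀ ℕ, ((β.degree : ℝ) + 1) ^ (k + l + n + 1) * ‖m β * hermiteCoeff β f‖ := e1
    _ ≤ C * (M * ∑' β : σ →₀ ℕ, ((β.degree : ℝ) + 1) ^ (k + l + n + 1 + a) * ‖hermiteCoeff β f‖) := by
        gcongr
    _ ≤ C * (M * (2 ^ j * (Real.sqrt (∫ x : EuclideanSpace ℝ σ, ‖f x‖ ^ 2) +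
          Real.sqrt (∫ x : EuclideanSpace ℝ σ, ‖(numberOpCLM ^ j) f x‖ ^ 2)) * W)) := by
        gcongr
    _ ≤ C * (M * (2 ^ j * (C₁ * S f + C₂ * S f) * W)) := by
        gcongr
    _ = C * (M * (2 ^ j * (C₁ + C₂) * W)) * S f := by ring

/-- **The Hermite multiplier operator `T_m : 𝒮(ℝ^σ, ℂ) →L[ℂ] 𝒮(ℝ^σ, ℂ)`**, `T_m f = Σ_β m_β c_β(f) h_β`, for a multiplier of
polynomial growth. [cite: Folland1989, §1.7] -/
def hermiteMultiplierCLM (hm : IsPolyBounded m a M) : 𝓢(EuclideanSpace ℝ σ, ℂ) →L[ℂ] 𝓢(EuclideanSpace ℝ σ, ℂ) :=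
  ⟨hermiteMultiplierₗ m hm, continuous_hermiteMultiplierₗ m hm⟩

/-- Unfolding. [folklore] -/
theorem hermiteMultiplierCLM_apply (hm : IsPolyBounded m a M) (f : 𝓢(EuclideanSpace ℝ σ, ℂ)) :
    hermiteMultiplierCLM m hm f = ∑' β : σ →₀ ℕ, (m β * hermiteCoeff β f) • hermiteSchwartz (herm β) :=
  rfl

/-- `Σ_β m_β c_β(f) h_β = T_m f` in `𝒮(ℝ^σ)`. [folklore] -/
theorem hasSum_hermiteMultiplierCLM (hm : IsPolyBounded m a M) (f : 𝓢(EuclideanSpace ℝ σ, ℂ)) :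
    HasSum (fun β : σ →₀ ℕ => (m β * hermiteCoeff β f) • hermiteSchwartz (herm β)) (hermiteMultiplierCLM m hm f) :=
  hasSum_hermiteMultiplierₗ m hm f

/-- **`c_α(T_m f) = m_α c_α(f)`.** [cite: Folland1989, §1.7] -/
@[simp]
theorem hermiteCoeff_hermiteMultiplierCLM (hm : IsPolyBounded m a M) (f : 𝓢(EuclideanSpace ℝ σ, ℂ)) (α : σ →₀ ℕ) :
    hermiteCoeff α (hermiteMultiplierCLM m hm f) = m α * hermiteCoeff α f :=
  hermiteCoeff_hermiteMultiplierₗ m hm f α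

/-- **`T_m h_α = m_α h_α`**: the Hermite functions diagonalise every multiplier. [cite: Folland1989, §1.7] -/
theorem hermiteMultiplierCLM_herm (hm : IsPolyBounded m a M) (α : σ →₀ ℕ) :
    hermiteMultiplierCLM m hm (hermiteSchwartz (herm α)) = m α • hermiteSchwartz (herm α) := by
  refine ext_hermiteCoeff fun β => ?_
  rw [hermiteCoeff_hermiteMultiplierCLM, hermiteCoeff_smul, hermiteCoeff_herm]
  split_ifs with h
  · rw [h]
  · rw [mul_zero, mul_zero]

/-- **`T_{m m'} = T_m ∘ T_{m'}`.** [folklore] -/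
theorem hermiteMultiplierCLM_mul (hm : IsPolyBounded m a M) (hm' : IsPolyBounded m' a' M')
    (f : 𝓢(EuclideanSpace ℝ σ, ℂ)) :
    hermiteMultiplierCLM (m * m') (hm.mul hm') f = hermiteMultiplierCLM m hm (hermiteMultiplierCLM m' hm' f) := by
  refine ext_hermiteCoeff fun β => ?_
  rw [hermiteCoeff_hermiteMultiplierCLM, hermiteCoeff_hermiteMultiplierCLM, hermiteCoeff_hermiteMultiplierCLM,
    Pi.mul_apply, mul_assoc]

/-- Multipliers commute: `T_m T_{m'} = T_{m'} T_m`. [folklore] -/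
theorem hermiteMultiplierCLM_comm (hm : IsPolyBounded m a M) (hm' : IsPolyBounded m' a' M')
    (f : 𝓢(EuclideanSpace ℝ σ, ℂ)) :
    hermiteMultiplierCLM m hm (hermiteMultiplierCLM m' hm' f) = hermiteMultiplierCLM m' hm' (hermiteMultiplierCLM m hm f) := by
  refine ext_hermiteCoeff fun β => ?_
  simp only [hermiteCoeff_hermiteMultiplierCLM]
  ring

omit [Fintype σ] [DecidableEq σ] in
/-- The constant multiplier `1` is bounded. [folklore] -/
theorem isPolyBounded_one : IsPolyBounded (fun _ : σ →₀ ℕ => (1 : ℂ)) 0 1 :=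
  isPolyBounded_of_norm_le fun _ => by rw [norm_one]

/-- **`T_1 = 1`** (the Hermite expansion of `f` sums to `f`). [cite: Folland1989, §1.7] -/
theorem hermiteMultiplierCLM_one (f : 𝓢(EuclideanSpace ℝ σ, ℂ)) :
    hermiteMultiplierCLM (fun _ : σ →₀ ℕ => (1 : ℂ)) isPolyBounded_one f = f := by
  refine ext_hermiteCoeff fun β => ?_
  rw [hermiteCoeff_hermiteMultiplierCLM, one_mul]

variable {m}

/-- Dependence on the multiplier only (not on the chosen bound). [folklore] -/
theorem hermiteMultiplierCLM_congr (hm : IsPolyBounded m a M) (hm' : IsPolyBounded m' a' M') (h : ∀ β, m β = m' β)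
    (f : 𝓢(EuclideanSpace ℝ σ, ℂ)) :
    hermiteMultiplierCLM m hm f = hermiteMultiplierCLM m' hm' f := by
  refine ext_hermiteCoeff fun β => ?_
  rw [hermiteCoeff_hermiteMultiplierCLM, hermiteCoeff_hermiteMultiplierCLM, h β]

end Multiplier

end Literature.Analysis.SegalBargmann

end
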